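/-
Copyright: statement-level skeleton of a published paper (lit-balaban cell, Phase-2 proof seat p39 gen 9). No proof claims
beyond what the kernel checks below.
-/
import Literature.MathematicalPhysics.QuantumFieldTheory.Balaban1983to89.B3Eq316DifferenceKernelBounds
import Literature.MathematicalPhysics.QuantumFieldTheory.Balaban1983to89.B3Eq329WardVanishing

/-!
# B3 — T. Bałaban, *(Higgs)₂,₃ quantum fields in a finite volume. III. Renormalization*, CMP **88** (1983) 411–445
[Balaban1983Higgs3], (3.26)/(3.29) pp. 440–442 [PDF 30–32]: **the vector self-energy kernel Π_{μμ′} of (3.26) with the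
infinite-lattice propagator `G^ξ_{j₀}(0)` in all three slots is bounded uniformly in the lattice spacing** — ON THE PRINTED
INFINITE LATTICE ξℤ³, where the pure-`C^ξ` part VANISHES EXACTLY (p. 442: *"hence it is equal to 0"*, p20's `Pi2Z_Cxi_eq_zero`)

statement-level skeleton of published theorems with citation tags; proofs where landed; nothing here is a claim about
the Yang–Mills mass gap

PDF held: `paper:balaban1983-higgs-2-3-quantum-fields-finite-volume` (journal page = PDF page + 410); pp. 440–442 [PDF 30–32] read
on the ×2 renders `run/shared/lean/pub/pub-balaban/b2b-balaban-ref1/pages/1983-cmp88-higgs23-III/1983-cmp88-higgs23-III-p030-x2.png`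
… `-p032-x2.png`.  p. 441 [PDF 31], verbatim: *"We consider the case d = 3, so −d + 2 = −1, −d + 3 = 0. Next we replace the
propagator G_{j₀}(0) by C^ξ, ξ = L^{−j₀}, using the same equation as in (3.16). If at least one propagator G_{j₀}(0) is replaced
by G_{j₀}(0)(1 − m²_{j₀} − a_{j₀}P_{j₀})C^ξ, then we get a convergent expression. Hence it is enough to consider the expressions
with the propagator C^ξ only."* — our reading (a paraphrase, NOT the print): every term containing at least one difference
kernel `M = G_{j₀}(0) − C^ξ` is bounded uniformly in the spacing, so a divergence could only come from the pure-`C^ξ` term; and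
for that term, p. 441 *"Let us consider the corresponding term coming from Π^{(L^{−j₀},j₀)}_{μμ′}, and let us rescale the external
legs A, A′ from the η-lattice to the ξ-lattice also. We get the expression"* [(3.29)], whose square bracket, p. 442 [PDF 32],
*"has exactly the form appearing in the Ward-Takahashi identity (2.26) with M² = 1, hence it is equal to 0."*  (v1.1, r15 gen 10
= the B3 fold owner, 2026-08-22: DOCSTRING-ONLY — the p. 441 quotation made verbatim and the paraphrase moved outside the
quotation marks per referee ref-1 gen 52 (F4); the same in the docstring of `exists_Pi2L_GxiL_bound`; no declaration, statement
or proof changed.  v1.2, p39 gen 11, 2026-08-22: CITATION-TAG PAGE NUMERALS ONLY, per summit-lit1 CITELOC P48-003, P48-004 — the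
display (3.29) is printed on p. 441 and (3.26) on p. 440, the sentences quoted about them on pp. 441–442: tags `(3.29) p.442` →
`(3.29) p.441; p.442` and `(3.26) p.441` → `(3.26) p.440; p.441`; declarations byte-identical.)  Rows **B3.Eq3.25-3.32** (and B3.Eq3.11-3.17) of `HOME/lit-balaban-r15/ROWS-B3.md`
(fold owner r15); file 5 of the p39 gen-9 programme «the §3 vector self-energy sentences on the PRINTED infinite lattice ξℤ³»
(gens 6–8 of this seat proved the torus reading `B3Pi2TorusBounded`/`B3Pi2CxiTorusBounded`, where the pure-C^ξ part is only
bounded; on ξℤ³ it is zero, as printed).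
WHAT IS REPRODUCED (`d = 3`, `ξ = L^{−k}`, volume element `Σ ξ³`, `τ = tr q²`; `G = G^ξ_k(0)` = `GxiL`, `M = G − C^ξ` = `MxiL`):
* §1 `nonloc`, **`Pi2L`** — the kernel Π^{(η,j₀)}_{μμ′}(y) of the square bracket of (3.26) for three TWO-VARIABLE kernels on
  ξℤ³: `Π[K₁,K₂,K₃](y) = τΣ'_{y′}ξ³[−(K₁∂^*_{μ′})(y,y′)(K₂∂^*_μ)(y′,y) + K₁(y,y′)(∂_{μ′}K₂∂^*_μ)(y′,y)] − δ_{μμ′}τK₃(y,y) −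
  δ_{μμ′}τξ(K₃∂^*_μ)(y,y)` (r15's torus `Pi2`, the `y′`-sum a `tsum`); `Pi2L_conv`: on convolution kernels it IS p20's `Pi2Z`,
  hence `Pi2L_Cxi_eq_zero`: **the pure-C^ξ kernel vanishes on ξℤ³** (p20's `Pi2Z_Cxi_eq_zero`).
* §2 bilinearity of the non-local integrand, `G = C^ξ + M` (`GxiL_eq_conv_add`).
* §3 **`tsum_nonloc_conv_M_bound`** — the `[C^ξ, M]` cross term: after summation by parts in `y′` both pieces carry the mixed
  difference `(∂_{μ′}M∂^*_μ)`, whose law is `P₁^{δ/2}` (`B3Eq316DifferenceKernelBounds.abs_d2K_MxiL_le_of_laws`): bounded by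
  `C·K·(2e+1)·833/(δ/2)³`.
* §4 **`tsum_nonloc_M_G_bound`** — the `[M, G]` term (covers `[M,C^ξ]` and `[M,M]`): after summation by parts both pieces have
  the Fubini form `Σ_{y′}ξ³(M∂^*_{μ′})(y,y′)κ(y′)` with `κ = (G∂^*_μ)(·,y)` or its unit translate, `|κ| ≤ C·P₂^δ`, bounded by the
  Fubini bound of `B3Eq316DifferenceKernelBounds` (`x′`-sum first: `P₂⋆P₂ ≤ 1400P₁`): `≤ K·C·(1 + 4e)`.
* §5 **`exists_Pi2L_GxiL_bound`** — THE PRINTED CLAIM for the first picture of (3.30): there is `Cst` (a function of `L` and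
  the window only) with `|Π[G^ξ_k(0),G^ξ_k(0),G^ξ_k(0)]_{μμ′}(y)| ≤ Cst·|tr q²|` for every `k ≥ 1`, `(a,m²)` in the window,
  `μ, μ′, y` — *"we can estimate (3.16) by a constant"* / *"we get a convergent expression"* — via the decomposition
  `Π[G,G,G] = Π[C,C,C] + τΣ nonloc[C,M] + τΣ nonloc[M,G] − δ_{μμ′}τM(y,y+e_μ)` (`Pi2L_GxiL_decomp`) and `Π[C,C,C] = 0`.
HONEST SCOPE: zero external field, `d = 3`, unit blocks, one scale `j₀ = k` in all three slots (the printed pictures mix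
`G_{j₀}, G_{j′₀}, G_{j″₀}`; the estimates are identical), the `y`-independent localization weights `h, g, A` of (3.26) left
outside (they enter the finite `Σ_y ξ³ g A Π g′A′` of r15's `bracket326`); constants existential.  Mathlib + the cited tree files
only; definitions with bodies and theorems, no named facts; standard axioms.  Unit `lit-balaban-p39-g9` (Phase-2 proof seat p39,
gen 9), HOME `run/shared/lean/pub/lit-balaban/`, 2026-08-22.
-/

open scoped BigOperators
open Finset Filter Topology

namespace Literature.MathematicalPhysics.QuantumFieldTheory.Balaban1983to89.B3Pi2ZeroLattice

open B3Sect3VectorSelfEnergy B3CxiUniformBound B3ZdLatticeProfileSums B3ZdKernelConvolutions B3Eq316ResolventZeroLattice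
  B3Eq316DifferenceKernelBounds
open B3Eq329WardVanishing (Pi2Z Pi2Z_Cxi_eq_zero)
open B3CxiLatticePairSums (supNorm_unitVec)

noncomputable section

/-! ## §1 Π_{μμ′} on ξℤ³ for two-variable kernels -/

/-- the non-local integrand of (3.26): `ξ³[−(K₁∂^{ξ*}_{μ′})(y,y′)(K₂∂^{ξ*}_μ)(y′,y) + K₁(y,y′)(∂^ξ_{μ′}K₂∂^{ξ*}_μ)(y′,y)]`.
[cite: Balaban1983Higgs3, (3.26) p.440] -/
def nonloc (ξ : ℝ) (K₁ K₂ : ZSite 3 → ZSite 3 → ℝ) (μ μ' : Fin 3) (y y' : ZSite 3) : ℝ :=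
  ξ ^ 3 * (-(dK2 ξ μ' K₁ y y' * dK2 ξ μ K₂ y' y) + K₁ y y' * d2K ξ μ' μ K₂ y' y)

/-- **Π_{μμ′}[K₁,K₂,K₃](y)** — the kernel of the square bracket of (3.26) p. 440 (r15's `B3Sect3VectorSelfEnergy.Pi2`) ON THE
INFINITE LATTICE ξℤ³ for three two-variable kernels (the three propagator slots `G_{j₀}(0), G_{j′₀}(0), G_{j″₀}(0)`):
`τΣ'_{y′} nonloc[K₁,K₂](y,y′) − δ_{μμ′}τK₃(y,y) − δ_{μμ′}τ·ξ(K₃∂^{ξ*}_μ)(y,y)`, `τ = tr q²`. [cite: Balaban1983Higgs3, (3.26) p.440] -/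
def Pi2L (ξ τ : ℝ) (K₁ K₂ K₃ : ZSite 3 → ZSite 3 → ℝ) (μ μ' : Fin 3) (y : ZSite 3) : ℝ :=
  τ * (∑' y', nonloc ξ K₁ K₂ μ μ' y y')
    - (if μ = μ' then τ * K₃ y y else 0) - (if μ = μ' then τ * (ξ * dK2 ξ μ K₃ y y) else 0)

section Algebra

variable {ξ : ℝ}

/-- **On convolution kernels `Π_{μμ′}` is p20's `Pi2Z`.** [cite: Balaban1983Higgs3, (3.29) p.441] -/
theorem Pi2L_conv (ξ τ : ℝ) (C : ZSite 3 → ℝ) (μ μ' : Fin 3) (y : ZSite 3) :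
    Pi2L ξ τ (fun a b => C (a - b)) (fun a b => C (a - b)) (fun a b => C (a - b)) μ μ' y = Pi2Z 3 ξ τ C μ μ' y := by
  simp only [Pi2L, Pi2Z, nonloc, dK2_conv, d2K_conv, sub_self]

/-- **THE PURE-C^ξ KERNEL VANISHES ON ξℤ³** (p. 442: *"hence it is equal to 0"*; p20's `Pi2Z_Cxi_eq_zero`).
[cite: Balaban1983Higgs3, (3.29) p.441; p.442] -/
theorem Pi2L_Cxi_eq_zero (hξ : 0 < ξ) (τ : ℝ) (μ μ' : Fin 3) (y : ZSite 3) :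
    Pi2L ξ τ (fun a b => Cxi 3 ξ (a - b)) (fun a b => Cxi 3 ξ (a - b)) (fun a b => Cxi 3 ξ (a - b)) μ μ' y = 0 := by
  rw [Pi2L_conv]; exact Pi2Z_Cxi_eq_zero hξ τ μ μ' y

/-- kernel: `K∂^*` is additive in the kernel. [cite: Balaban1983Higgs3, (3.26) p.440] -/
theorem dK2_add (ξ : ℝ) (μ : Fin 3) (K K' : ZSite 3 → ZSite 3 → ℝ) (x y : ZSite 3) :
    dK2 ξ μ (K + K') x y = dK2 ξ μ K x y + dK2 ξ μ K' x y := by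
  simp only [dK2, Pi.add_apply]; ring

/-- kernel: `∂K∂^*` is additive in the kernel. [cite: Balaban1983Higgs3, (3.26) p.440] -/
theorem d2K_add (ξ : ℝ) (μ' μ : Fin 3) (K K' : ZSite 3 → ZSite 3 → ℝ) (x y : ZSite 3) :
    d2K ξ μ' μ (K + K') x y = d2K ξ μ' μ K x y + d2K ξ μ' μ K' x y := by
  simp only [d2K, Pi.add_apply]; ring

/-- the non-local integrand is additive in the first slot. [cite: Balaban1983Higgs3, (3.26) p.440] -/
theorem nonloc_add_left (ξ : ℝ) (K₁ K₁' K₂ : ZSite 3 → ZSite 3 → ℝ) (μ μ' : Fin 3) (y y' : ZSite 3) :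
    nonloc ξ (K₁ + K₁') K₂ μ μ' y y' = nonloc ξ K₁ K₂ μ μ' y y' + nonloc ξ K₁' K₂ μ μ' y y' := by
  simp only [nonloc, dK2_add, Pi.add_apply]; ring

/-- the non-local integrand is additive in the second slot. [cite: Balaban1983Higgs3, (3.26) p.440] -/
theorem nonloc_add_right (ξ : ℝ) (K₁ K₂ K₂' : ZSite 3 → ZSite 3 → ℝ) (μ μ' : Fin 3) (y y' : ZSite 3) :
    nonloc ξ K₁ (K₂ + K₂') μ μ' y y' = nonloc ξ K₁ K₂ μ μ' y y' + nonloc ξ K₁ K₂' μ μ' y y' := by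
  simp only [nonloc, dK2_add, d2K_add]; ring

/-- `G^ξ_k(0) = C^ξ + M` as two-variable kernels. [cite: Balaban1983Higgs3, (3.16) p.437] -/
theorem GxiL_eq_conv_add (ℓ k : ℕ) (a m2 : ℝ) :
    GxiL ℓ k a m2 = (fun x y => Cxi 3 (xiOf ℓ k) (x - y)) + MxiL ℓ k a m2 := by
  funext x y; simp only [Pi.add_apply, MxiL]; ring

end Algebra

/-! ## §2 Summability helpers -/

section Summability

variable {ξ δ : ℝ}

/-- kernel: `P_q^δ(u) ≤ ξ^{−q}`. [cite: Balaban1983Higgs3, (3.16) p.437] -/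
theorem prof_le_inv (hξ : 0 < ξ) (hδ : 0 ≤ δ) (q : ℕ) (u : ZSite 3) : prof ξ δ q u ≤ (ξ ^ q)⁻¹ :=
  profile_le_inv_pow hξ hδ q u

/-- kernel: `y′ ↦ P_q^δ(y′ − y)` is summable (`q ≤ 2`). [cite: Balaban1983Higgs3, (3.16) p.437] -/
theorem summable_prof_col (hξ : 0 < ξ) (hξ1 : ξ ≤ 1) (hδ : 0 < δ) (hδ1 : δ ≤ 1) {q : ℕ} (hq : q ≤ 2) (y : ZSite 3) :
    Summable fun y' : ZSite 3 => prof ξ δ q (y' - y) := by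
  have h := summable_profile_row hξ hξ1 hδ hδ1 hq y
  refine h.congr fun y' => ?_
  rw [show prof ξ δ q (y' - y) = prof ξ δ q (y - y') from prof_sub_comm ξ δ q y' y, prof]

/-- kernel: (bounded) × (profile-bounded column) is absolutely summable. [cite: Balaban1983Higgs3, (3.16) p.437] -/
theorem summable_abs_bdd_mul_prof (hξ : 0 < ξ) (hξ1 : ξ ≤ 1) (hδ : 0 < δ) (hδ1 : δ ≤ 1) {q : ℕ} (hq : q ≤ 2)
    {f g : ZSite 3 → ℝ} {B C' : ℝ} (y : ZSite 3) (hf : ∀ y', |f y'| ≤ B) (hg : ∀ y', |g y'| ≤ C' * prof ξ δ q (y' - y)) :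
    Summable fun y' => |f y' * g y'| := by
  have hB : 0 ≤ B := (abs_nonneg _).trans (hf y)
  refine Summable.of_nonneg_of_le (fun _ => abs_nonneg _) (fun y' => ?_)
    (((summable_prof_col hξ hξ1 hδ hδ1 hq y).mul_left C').mul_left B)
  rw [abs_mul]
  exact mul_le_mul (hf y') (hg y') (abs_nonneg _) hB

/-- kernel: (profile-bounded row) × (bounded) is absolutely summable. [cite: Balaban1983Higgs3, (3.16) p.437] -/
theorem summable_abs_prof_mul_bdd (hξ : 0 < ξ) (hξ1 : ξ ≤ 1) (hδ : 0 < δ) (hδ1 : δ ≤ 1) {q : ℕ} (hq : q ≤ 2)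
    {f g : ZSite 3 → ℝ} {B C' : ℝ} (y : ZSite 3) (hf : ∀ y', |f y'| ≤ C' * prof ξ δ q (y - y')) (hg : ∀ y', |g y'| ≤ B) :
    Summable fun y' => |f y' * g y'| := by
  have h := summable_abs_bdd_mul_prof hξ hξ1 hδ hδ1 hq y hg (fun y' => (hf y').trans_eq (by rw [prof_sub_comm]))
  simpa only [mul_comm] using h

end Summability

/-! ## §3 The `[C^ξ, M]` cross term -/

section CrossCM

variable {ℓ k : ℕ} {a m2 : ℝ}

/-- **THE `[C^ξ, M]` CROSS TERM OF (3.26) IS BOUNDED**: given the laws (rate `δ`, constant `C`) and the bounds of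
`B3Eq316DifferenceKernelBounds` (constant `K`), `y′ ↦ nonloc[C^ξ, M](y,y′)` is summable and
`|Σ'_{y′} nonloc[C^ξ,M](y,y′)| ≤ C·K·(2e+1)·833/(δ/2)³`, uniformly in `k`: summation by parts moves `∂^*_{μ′}` from `C^ξ` onto
`M∂^*_μ`, so both pieces are `Σ_{y′}ξ³C^ξ(y−y′)(∂_{μ′}M∂^*_μ)(y′[−e_{μ′}],y)` with `|∂M∂^*| ≤ K·P₁^{δ/2}`.
[cite: Balaban1983Higgs3, (3.26) p.440; p.441] -/
theorem tsum_nonloc_conv_M_bound {δ C K : ℝ} (hδ : 0 < δ) (hδ1 : δ ≤ 1) (hC : 0 ≤ C) (hK : 0 ≤ K)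
    (l7 : ∀ u : ZSite 3, |Cxi 3 (xiOf ℓ k) u| ≤ C * prof (xiOf ℓ k) δ 1 u)
    (bd2 : ∀ (μ' μ : Fin 3) (x y : ZSite 3), |d2K (xiOf ℓ k) μ' μ (MxiL ℓ k a m2) x y| ≤ K * prof (xiOf ℓ k) (δ / 2) 1 (x - y))
    (bunif : ∀ (μ' : Fin 3) (y x' : ZSite 3), |dK2 (xiOf ℓ k) μ' (MxiL ℓ k a m2) y x'| ≤ (xiOf ℓ k)⁻¹ * K)
    (μ μ' : Fin 3) (y : ZSite 3) :
    Summable (fun y' => nonloc (xiOf ℓ k) (fun x z => Cxi 3 (xiOf ℓ k) (x - z)) (MxiL ℓ k a m2) μ μ' y y') ∧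
      |∑' y', nonloc (xiOf ℓ k) (fun x z => Cxi 3 (xiOf ℓ k) (x - z)) (MxiL ℓ k a m2) μ μ' y y'| ≤
        C * K * (2 * Real.exp 1 + 1) * (833 / (δ / 2) ^ 3) := by
  set ξ : ℝ := xiOf ℓ k with hξdef
  have hξ : 0 < ξ := xiOf_pos ℓ k
  have hξ1 : ξ ≤ 1 := xiOf_le_one ℓ k
  have hδh : 0 < δ / 2 := by linarith
  have hδh1 : δ / 2 ≤ 1 := by linarith
  set e' : ZSite 3 := unitVec μ' with he'
  -- names
  set Cf : ZSite 3 → ℝ := fun y' => Cxi 3 ξ (y - y') with hCfdef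
  set dM : ZSite 3 → ℝ := fun y' => dK2 ξ μ (MxiL ℓ k a m2) y' y with hdMdef
  set d2M : ZSite 3 → ℝ := fun y' => d2K ξ μ' μ (MxiL ℓ k a m2) y' y with hd2Mdef
  -- laws in the needed shapes
  have hCf : ∀ y', |Cf y'| ≤ C * prof ξ δ 1 (y - y') := fun y' => l7 (y - y')
  have hCf' : ∀ y', |Cf (y' + e')| ≤ C * prof ξ δ 1 (y - e' - y') := fun y' => by
    simp only [hCfdef]; rw [show y - (y' + e') = y - e' - y' by abel]; exact l7 _
  have hdMb : ∀ y', |dM y'| ≤ ξ⁻¹ * K := fun y' => bunif μ y' y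
  have hd2 : ∀ y', |d2M y'| ≤ K * prof ξ (δ / 2) 1 (y' - y) := fun y' => bd2 μ' μ y' y
  have hd2s : ∀ y', |d2M (y' - e')| ≤ K * (2 * Real.exp 1) * prof ξ (δ / 2) 1 (y' - y) := by
    intro y'
    refine (bd2 μ' μ (y' - e') y).trans ?_
    rw [show y' - e' - y = (y' - y) + (-e') by abel, mul_assoc]
    refine mul_le_mul_of_nonneg_left ?_ hK
    have hs : supNorm (-e') ≤ 1 := by rw [he', (supNorm_unitVec μ').2]
    have h := prof_shift_le hξ hξ1 hδh.le hδh1 1 (y' - y) (-e') hs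
    simpa [pow_one] using h
  have hd2b : ∀ y', |d2M y'| ≤ K * ξ⁻¹ := fun y' => (hd2 y').trans
    (mul_le_mul_of_nonneg_left ((prof_le_inv hξ hδh.le 1 _).trans_eq (by rw [pow_one])) hK)
  -- (i) the integrand, rewritten
  have hint : ∀ y', nonloc ξ (fun x z => Cxi 3 ξ (x - z)) (MxiL ℓ k a m2) μ μ' y y' =
      -(ξ ^ 2 * (Cf (y' + e') * dM y')) + ξ ^ 2 * (Cf y' * dM y') + ξ ^ 3 * (Cf y' * d2M y') := by
    intro y'
    simp only [nonloc, dK2_conv, pdiffAdjZ, hCfdef, hdMdef, hd2Mdef, he']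
    rw [show y - (y' + unitVec μ') = y - y' - unitVec μ' by abel]
    have hξ0 : ξ ≠ 0 := hξ.ne'
    field_simp
    ring
  -- (ii) summability of the three pieces
  have s1 : Summable fun y' => Cf (y' + e') * dM y' := by
    have h := summable_abs_prof_mul_bdd hξ hξ1 hδ hδ1 (by norm_num : 1 ≤ 2) (y - e') hCf' hdMb
    exact h.of_abs
  have s2 : Summable fun y' => Cf y' * dM y' :=
    (summable_abs_prof_mul_bdd hξ hξ1 hδ hδ1 (by norm_num : 1 ≤ 2) y hCf hdMb).of_abs
  have s3 : Summable fun y' => Cf y' * d2M y' :=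
    (summable_abs_prof_mul_bdd hξ hξ1 hδ hδ1 (by norm_num : 1 ≤ 2) y hCf hd2b).of_abs
  have s3' : Summable fun y' => Cf y' * d2M (y' - e') := by
    have hb : ∀ y', |d2M (y' - e')| ≤ K * ξ⁻¹ := fun y' => hd2b _
    exact (summable_abs_prof_mul_bdd hξ hξ1 hδ hδ1 (by norm_num : 1 ≤ 2) y hCf hb).of_abs
  have hsum : Summable (fun y' => nonloc ξ (fun x z => Cxi 3 ξ (x - z)) (MxiL ℓ k a m2) μ μ' y y') := by
    simp_rw [hint]
    exact ((s1.mul_left _).neg.add (s2.mul_left _)).add (s3.mul_left _)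
  refine ⟨hsum, ?_⟩
  -- (iii) summation by parts: `Σ C(y−y′−e′)dM(y′) − Σ C(y−y′)dM(y′) = −ξ Σ C(y−y′)(∂M∂^*)(y′−e′,y)`
  have hre : ∑' y', Cf (y' + e') * dM y' = ∑' y', Cf y' * dM (y' - e') := by
    rw [← (Equiv.subRight e').tsum_eq (fun y' => Cf (y' + e') * dM y')]
    simp only [Equiv.subRight_apply, sub_add_cancel]
  have hparts : ∑' y', Cf (y' + e') * dM y' - ∑' y', Cf y' * dM y' = -(ξ * ∑' y', Cf y' * d2M (y' - e')) := by
    rw [hre, ← s3'.tsum_mul_left ξ, ← tsum_neg]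
    have s1' : Summable fun y' => Cf y' * dM (y' - e') := by
      have hb : ∀ y', |dM (y' - e')| ≤ ξ⁻¹ * K := fun y' => hdMb _
      exact (summable_abs_prof_mul_bdd hξ hξ1 hδ hδ1 (by norm_num : 1 ≤ 2) y hCf hb).of_abs
    rw [← s1'.tsum_sub s2]
    refine tsum_congr fun y' => ?_
    simp only [hd2Mdef, hdMdef, d2K_eq_dK1_dK2, dK1, he', sub_add_cancel]
    field_simp
    ring
  -- (iv) the value of the sum
  have hval : ∑' y', nonloc ξ (fun x z => Cxi 3 ξ (x - z)) (MxiL ℓ k a m2) μ μ' y y' =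
      ξ ^ 3 * ∑' y', Cf y' * d2M (y' - e') + ξ ^ 3 * ∑' y', Cf y' * d2M y' := by
    simp_rw [hint]
    rw [((s1.mul_left _).neg.add (s2.mul_left _)).tsum_add (s3.mul_left _), (s1.mul_left _).neg.tsum_add (s2.mul_left _),
      tsum_neg, tsum_mul_left, tsum_mul_left, tsum_mul_left]
    have : -(ξ ^ 2 * ∑' y', Cf (y' + e') * dM y') + ξ ^ 2 * ∑' y', Cf y' * dM y' =
        -(ξ ^ 2 * (∑' y', Cf (y' + e') * dM y' - ∑' y', Cf y' * dM y')) := by ring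
    rw [this, hparts]
    ring
  -- (v) the bound
  obtain ⟨hps, hple⟩ := tsum_profile_one_mul_le hξ hξ1 hδh hδh1 y y
  have hP : ∀ y', prof ξ δ 1 (y - y') ≤ prof ξ (δ / 2) 1 (y - y') := fun y' => prof_mono_rate hξ.le (by linarith) 1 _
  have hb1 : |∑' y', Cf y' * d2M (y' - e')| ≤ C * (K * (2 * Real.exp 1)) *
      ∑' y', prof ξ (δ / 2) 1 (y - y') * prof ξ (δ / 2) 1 (y' - y) := by
    rw [← tsum_mul_left]
    have hs : Summable fun y' => C * (K * (2 * Real.exp 1)) * (prof ξ (δ / 2) 1 (y - y') * prof ξ (δ / 2) 1 (y' - y)) := by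
      have := (hps.mul_left ((ξ ^ 3)⁻¹ * (C * (K * (2 * Real.exp 1)))))
      refine this.congr fun y' => ?_
      simp only [prof]; field_simp
    refine abs_tsum_le_tsum_of_abs_le s3' hs fun y' => ?_
    rw [abs_mul]
    have hp := prof_nonneg hξ.le (δ / 2) 1 (y - y')
    calc |Cf y'| * |d2M (y' - e')| ≤ (C * prof ξ (δ / 2) 1 (y - y')) * (K * (2 * Real.exp 1) * prof ξ (δ / 2) 1 (y' - y)) :=
          mul_le_mul ((hCf y').trans (mul_le_mul_of_nonneg_left (hP y') hC)) (hd2s y') (abs_nonneg _) (by positivity)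
      _ = _ := by ring
  have hb2 : |∑' y', Cf y' * d2M y'| ≤ C * K * ∑' y', prof ξ (δ / 2) 1 (y - y') * prof ξ (δ / 2) 1 (y' - y) := by
    rw [← tsum_mul_left]
    have hs : Summable fun y' => C * K * (prof ξ (δ / 2) 1 (y - y') * prof ξ (δ / 2) 1 (y' - y)) := by
      have := (hps.mul_left ((ξ ^ 3)⁻¹ * (C * K)))
      refine this.congr fun y' => ?_
      simp only [prof]; field_simp
    refine abs_tsum_le_tsum_of_abs_le s3 hs fun y' => ?_
    rw [abs_mul]
    have hp := prof_nonneg hξ.le (δ / 2) 1 (y - y')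
    calc |Cf y'| * |d2M y'| ≤ (C * prof ξ (δ / 2) 1 (y - y')) * (K * prof ξ (δ / 2) 1 (y' - y)) :=
          mul_le_mul ((hCf y').trans (mul_le_mul_of_nonneg_left (hP y') hC)) (hd2 y') (abs_nonneg _) (by positivity)
      _ = _ := by ring
  have hS : ξ ^ 3 * ∑' y', prof ξ (δ / 2) 1 (y - y') * prof ξ (δ / 2) 1 (y' - y) ≤ 833 / (δ / 2) ^ 3 := by
    rw [← tsum_mul_left]; exact hple
  have hS0 : 0 ≤ ∑' y', prof ξ (δ / 2) 1 (y - y') * prof ξ (δ / 2) 1 (y' - y) :=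
    tsum_nonneg fun y' => mul_nonneg (prof_nonneg hξ.le _ _ _) (prof_nonneg hξ.le _ _ _)
  rw [hval]
  calc |ξ ^ 3 * ∑' y', Cf y' * d2M (y' - e') + ξ ^ 3 * ∑' y', Cf y' * d2M y'|
      ≤ |ξ ^ 3 * ∑' y', Cf y' * d2M (y' - e')| + |ξ ^ 3 * ∑' y', Cf y' * d2M y'| := abs_add_le _ _
    _ = ξ ^ 3 * |∑' y', Cf y' * d2M (y' - e')| + ξ ^ 3 * |∑' y', Cf y' * d2M y'| := by
        rw [abs_mul, abs_mul, abs_of_pos (by positivity : (0 : ℝ) < ξ ^ 3)]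
    _ ≤ ξ ^ 3 * (C * (K * (2 * Real.exp 1)) * ∑' y', prof ξ (δ / 2) 1 (y - y') * prof ξ (δ / 2) 1 (y' - y)) +
        ξ ^ 3 * (C * K * ∑' y', prof ξ (δ / 2) 1 (y - y') * prof ξ (δ / 2) 1 (y' - y)) := by gcongr
    _ = C * K * (2 * Real.exp 1 + 1) * (ξ ^ 3 * ∑' y', prof ξ (δ / 2) 1 (y - y') * prof ξ (δ / 2) 1 (y' - y)) := by ring
    _ ≤ C * K * (2 * Real.exp 1 + 1) * (833 / (δ / 2) ^ 3) := mul_le_mul_of_nonneg_left hS (by positivity)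

end CrossCM

/-! ## §4 The `[M, G]` term -/

section CrossMG

variable {ℓ k : ℕ} {a m2 : ℝ}

/-- **THE `[M, K]` TERM OF (3.26) IS BOUNDED** for any second kernel `K` with `|(K∂^*_μ)(y′,y)| ≤ C·P₂^δ(y′−y)` (here
`K = G^ξ_k(0)`, which covers `[M,C^ξ] + [M,M]`): given the bounds of `B3Eq316DifferenceKernelBounds` — `|M| ≤ K`,
`|M∂^*| ≤ Kξ^{−1}` and the Fubini bound — `y′ ↦ nonloc[M,G](y,y′)` is summable and `|Σ'_{y′} nonloc[M,G](y,y′)| ≤ K·C·(1 + 4e)`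
uniformly in `k`: summation by parts moves `∂_{μ′}` from `G∂^*_μ` onto `M`, leaving two Fubini forms
`Σ_{y′}ξ³(M∂^*_{μ′})(y,y′)κ(y′)` with `κ = (G∂^*_μ)(·,y)` and its unit translate. [cite: Balaban1983Higgs3, (3.26) p.440; p.441] -/
theorem tsum_nonloc_M_G_bound {δ C K : ℝ} (hδ : 0 < δ) (hδ1 : δ ≤ 1) (hC : 0 ≤ C)
    (l3 : ∀ (μ : Fin 3) (y z : ZSite 3), |dK2 (xiOf ℓ k) μ (GxiL ℓ k a m2) y z| ≤ C * prof (xiOf ℓ k) δ 2 (y - z))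
    (bM : ∀ y y' : ZSite 3, |MxiL ℓ k a m2 y y'| ≤ K)
    (fub : ∀ (μ' : Fin 3) (y : ZSite 3) (κ : ZSite 3 → ℝ) (b : ℝ), 0 ≤ b →
      (∀ x', |κ x'| ≤ b * prof (xiOf ℓ k) δ 2 (x' - y)) →
      Summable (fun x' => (xiOf ℓ k) ^ 3 * (dK2 (xiOf ℓ k) μ' (MxiL ℓ k a m2) y x' * κ x')) ∧
        |∑' x', (xiOf ℓ k) ^ 3 * (dK2 (xiOf ℓ k) μ' (MxiL ℓ k a m2) y x' * κ x')| ≤ K * b)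
    (μ μ' : Fin 3) (y : ZSite 3) :
    Summable (fun y' => nonloc (xiOf ℓ k) (MxiL ℓ k a m2) (GxiL ℓ k a m2) μ μ' y y') ∧
      |∑' y', nonloc (xiOf ℓ k) (MxiL ℓ k a m2) (GxiL ℓ k a m2) μ μ' y y'| ≤ K * C * (1 + 4 * Real.exp 1) := by
  set ξ : ℝ := xiOf ℓ k with hξdef
  have hξ : 0 < ξ := xiOf_pos ℓ k
  have hξ1 : ξ ≤ 1 := xiOf_le_one ℓ k
  set e' : ZSite 3 := unitVec μ' with he'
  set dG : ZSite 3 → ℝ := fun y' => dK2 ξ μ (GxiL ℓ k a m2) y' y with hdGdef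
  set dGs : ZSite 3 → ℝ := fun y' => dG (y' + e') with hdGsdef
  have hdG : ∀ y', |dG y'| ≤ C * prof ξ δ 2 (y' - y) := fun y' => l3 μ y' y
  have hdGs : ∀ y', |dGs y'| ≤ C * (4 * Real.exp 1) * prof ξ δ 2 (y' - y) := by
    intro y'
    simp only [hdGsdef]
    refine (hdG (y' + e')).trans ?_
    rw [show y' + e' - y = (y' - y) + e' by abel, mul_assoc]
    refine mul_le_mul_of_nonneg_left ?_ hC
    have hs : supNorm e' ≤ 1 := by rw [he', (supNorm_unitVec μ').1]
    have h := prof_shift_le hξ hξ1 hδ.le hδ1 2 (y' - y) e' hs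
    norm_num at h ⊢
    exact h
  have hMb : ∀ y', |MxiL ℓ k a m2 y y'| ≤ K := fun y' => bM y y'
  have hMb' : ∀ y', |MxiL ℓ k a m2 y (y' + e')| ≤ K := fun y' => bM y _
  -- (i) the integrand, rewritten
  have hint : ∀ y', nonloc ξ (MxiL ℓ k a m2) (GxiL ℓ k a m2) μ μ' y y' =
      -(ξ ^ 3 * (dK2 ξ μ' (MxiL ℓ k a m2) y y' * dG y')) + ξ ^ 2 * (MxiL ℓ k a m2 y y' * dGs y') -
        ξ ^ 2 * (MxiL ℓ k a m2 y y' * dG y') := by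
    intro y'
    simp only [nonloc, hdGdef, hdGsdef, he', d2K_eq_dK1_dK2]
    simp only [dK1]
    have hξ0 : ξ ≠ 0 := hξ.ne'
    field_simp
    ring
  -- (ii) summability
  obtain ⟨sA, hA⟩ := fub μ' y dG C hC hdG
  obtain ⟨sB, hB⟩ := fub μ' y dGs (C * (4 * Real.exp 1)) (by positivity) hdGs
  have s2 : Summable fun y' => MxiL ℓ k a m2 y y' * dGs y' :=
    (summable_abs_bdd_mul_prof hξ hξ1 hδ hδ1 le_rfl y hMb hdGs).of_abs
  have s3 : Summable fun y' => MxiL ℓ k a m2 y y' * dG y' :=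
    (summable_abs_bdd_mul_prof hξ hξ1 hδ hδ1 le_rfl y hMb hdG).of_abs
  have s2' : Summable fun y' => MxiL ℓ k a m2 y (y' + e') * dGs y' :=
    (summable_abs_bdd_mul_prof hξ hξ1 hδ hδ1 le_rfl y hMb' hdGs).of_abs
  have sB' : Summable fun y' => dK2 ξ μ' (MxiL ℓ k a m2) y y' * dGs y' := by
    have := sB.mul_left ((ξ ^ 3)⁻¹)
    refine this.congr fun y' => ?_
    field_simp
  have hsum : Summable (fun y' => nonloc ξ (MxiL ℓ k a m2) (GxiL ℓ k a m2) μ μ' y y') := by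
    simp_rw [hint]
    exact (sA.neg.add (s2.mul_left _)).sub (s3.mul_left _)
  refine ⟨hsum, ?_⟩
  -- (iii) summation by parts: `Σ M dGs − Σ M dG = −ξ Σ (M∂^*_{μ′}) dGs`
  have hre : ∑' y', MxiL ℓ k a m2 y y' * dG y' = ∑' y', MxiL ℓ k a m2 y (y' + e') * dGs y' := by
    rw [← (Equiv.addRight e').tsum_eq (fun y' => MxiL ℓ k a m2 y y' * dG y')]
    simp only [Equiv.coe_addRight, hdGsdef]
  have hparts : ∑' y', MxiL ℓ k a m2 y y' * dGs y' - ∑' y', MxiL ℓ k a m2 y y' * dG y' =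
      -(ξ * ∑' y', dK2 ξ μ' (MxiL ℓ k a m2) y y' * dGs y') := by
    rw [hre, ← sB'.tsum_mul_left ξ, ← tsum_neg, ← s2.tsum_sub s2']
    refine tsum_congr fun y' => ?_
    simp only [dK2, he']
    have hξ0 : ξ ≠ 0 := hξ.ne'
    field_simp
    ring
  have hval : ∑' y', nonloc ξ (MxiL ℓ k a m2) (GxiL ℓ k a m2) μ μ' y y' =
      -(∑' y', ξ ^ 3 * (dK2 ξ μ' (MxiL ℓ k a m2) y y' * dG y')) -
        ξ ^ 3 * ∑' y', dK2 ξ μ' (MxiL ℓ k a m2) y y' * dGs y' := by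
    simp_rw [hint]
    rw [(sA.neg.add (s2.mul_left _)).tsum_sub (s3.mul_left _), sA.neg.tsum_add (s2.mul_left _), tsum_neg,
      s2.tsum_mul_left (ξ ^ 2), s3.tsum_mul_left (ξ ^ 2)]
    linear_combination (ξ ^ 2) * hparts
  rw [hval, ← sB'.tsum_mul_left (ξ ^ 3)]
  calc |-(∑' y', ξ ^ 3 * (dK2 ξ μ' (MxiL ℓ k a m2) y y' * dG y')) -
        ∑' y', ξ ^ 3 * (dK2 ξ μ' (MxiL ℓ k a m2) y y' * dGs y')|
      ≤ |-(∑' y', ξ ^ 3 * (dK2 ξ μ' (MxiL ℓ k a m2) y y' * dG y'))| +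
        |∑' y', ξ ^ 3 * (dK2 ξ μ' (MxiL ℓ k a m2) y y' * dGs y')| := abs_sub _ _
    _ ≤ K * C + K * (C * (4 * Real.exp 1)) := by rw [abs_neg]; exact add_le_add hA hB
    _ = K * C * (1 + 4 * Real.exp 1) := by ring

end CrossMG

/-! ## §5 Assembly: Π_{μμ′}[G^ξ_k(0)] is bounded uniformly in the spacing -/

section Assembly

variable {ℓ k : ℕ} {a m2 : ℝ}

/-- kernel: the pure-`C^ξ` non-local integrand is summable (bounded × profile). [cite: Balaban1983Higgs3, (3.29) p.441] -/
theorem summable_nonloc_conv_conv {δ C : ℝ} (hδ : 0 < δ) (hδ1 : δ ≤ 1) (hC : 0 ≤ C)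
    (l7 : ∀ u : ZSite 3, |Cxi 3 (xiOf ℓ k) u| ≤ C * prof (xiOf ℓ k) δ 1 u)
    (l8 : ∀ (μ : Fin 3) (u : ZSite 3), |pdiffAdjZ (xiOf ℓ k)⁻¹ μ (Cxi 3 (xiOf ℓ k)) u| ≤ C * prof (xiOf ℓ k) δ 2 u)
    (μ μ' : Fin 3) (y : ZSite 3) :
    Summable (fun y' => nonloc (xiOf ℓ k) (fun x z => Cxi 3 (xiOf ℓ k) (x - z)) (fun x z => Cxi 3 (xiOf ℓ k) (x - z))
      μ μ' y y') := by
  set ξ : ℝ := xiOf ℓ k with hξdef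
  have hξ : 0 < ξ := xiOf_pos ℓ k
  have hξ1 : ξ ≤ 1 := xiOf_le_one ℓ k
  have hb1 : ∀ y', |pdiffAdjZ ξ⁻¹ μ' (Cxi 3 ξ) (y - y')| ≤ C * (ξ ^ 2)⁻¹ := fun y' =>
    (l8 μ' _).trans (mul_le_mul_of_nonneg_left (prof_le_inv hξ hδ.le 2 _) hC)
  have hp1 : ∀ y', |pdiffAdjZ ξ⁻¹ μ (Cxi 3 ξ) (y' - y)| ≤ C * prof ξ δ 2 (y' - y) := fun y' => l8 μ _
  have hb2 : ∀ y', |pdiffZ ξ⁻¹ μ' (pdiffAdjZ ξ⁻¹ μ (Cxi 3 ξ)) (y' - y)| ≤ ξ⁻¹ * (C * (ξ ^ 2)⁻¹ + C * (ξ ^ 2)⁻¹) := by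
    intro y'
    rw [pdiffZ, abs_mul, abs_of_pos (inv_pos.2 hξ)]
    refine mul_le_mul_of_nonneg_left ((abs_sub _ _).trans (add_le_add ?_ ?_)) (by positivity)
    · exact (l8 μ _).trans (mul_le_mul_of_nonneg_left (prof_le_inv hξ hδ.le 2 _) hC)
    · exact (l8 μ _).trans (mul_le_mul_of_nonneg_left (prof_le_inv hξ hδ.le 2 _) hC)
  have hp2 : ∀ y', |Cxi 3 ξ (y - y')| ≤ C * prof ξ δ 1 (y - y') := fun y' => l7 _
  have s1 := (summable_abs_bdd_mul_prof hξ hξ1 hδ hδ1 le_rfl y hb1 hp1).of_abs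
  have s2 := (summable_abs_prof_mul_bdd hξ hξ1 hδ hδ1 (by norm_num : 1 ≤ 2) y hp2 hb2).of_abs
  have h := (s1.neg.add s2).mul_left (ξ ^ 3)
  refine h.congr fun y' => ?_
  simp only [nonloc, dK2_conv, d2K_conv]

/-- **THE DECOMPOSITION** `Π[G,G,G] = Π[C^ξ,C^ξ,C^ξ] + τΣ' nonloc[C^ξ,M] + τΣ' nonloc[M,G] − δ_{μμ′}τM(y,y+e_μ)` (`G = C^ξ + M`,
bilinearity of the non-local integrand, the local terms of `M` combine to `M(y,y+e_μ)`), given summability of the three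
non-local pieces. [cite: Balaban1983Higgs3, (3.26) p.440; p.441] -/
theorem Pi2L_GxiL_decomp (τ : ℝ) (μ μ' : Fin 3) (y : ZSite 3)
    (sCC : Summable (fun y' => nonloc (xiOf ℓ k) (fun x z => Cxi 3 (xiOf ℓ k) (x - z))
      (fun x z => Cxi 3 (xiOf ℓ k) (x - z)) μ μ' y y'))
    (sCM : Summable (fun y' => nonloc (xiOf ℓ k) (fun x z => Cxi 3 (xiOf ℓ k) (x - z)) (MxiL ℓ k a m2) μ μ' y y'))
    (sMG : Summable (fun y' => nonloc (xiOf ℓ k) (MxiL ℓ k a m2) (GxiL ℓ k a m2) μ μ' y y')) :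
    Pi2L (xiOf ℓ k) τ (GxiL ℓ k a m2) (GxiL ℓ k a m2) (GxiL ℓ k a m2) μ μ' y =
      Pi2L (xiOf ℓ k) τ (fun x z => Cxi 3 (xiOf ℓ k) (x - z)) (fun x z => Cxi 3 (xiOf ℓ k) (x - z))
          (fun x z => Cxi 3 (xiOf ℓ k) (x - z)) μ μ' y +
        τ * ∑' y', nonloc (xiOf ℓ k) (fun x z => Cxi 3 (xiOf ℓ k) (x - z)) (MxiL ℓ k a m2) μ μ' y y' +
        τ * ∑' y', nonloc (xiOf ℓ k) (MxiL ℓ k a m2) (GxiL ℓ k a m2) μ μ' y y' -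
        (if μ = μ' then τ * MxiL ℓ k a m2 y (y + unitVec μ) else 0) := by
  have hG := GxiL_eq_conv_add ℓ k a m2
  have hsplit : ∀ y', nonloc (xiOf ℓ k) (GxiL ℓ k a m2) (GxiL ℓ k a m2) μ μ' y y' =
      nonloc (xiOf ℓ k) (fun x z => Cxi 3 (xiOf ℓ k) (x - z)) (fun x z => Cxi 3 (xiOf ℓ k) (x - z)) μ μ' y y' +
        nonloc (xiOf ℓ k) (fun x z => Cxi 3 (xiOf ℓ k) (x - z)) (MxiL ℓ k a m2) μ μ' y y' +
        nonloc (xiOf ℓ k) (MxiL ℓ k a m2) (GxiL ℓ k a m2) μ μ' y y' := by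
    intro y'
    conv_lhs => rw [hG]
    rw [nonloc_add_left, ← hG]
    conv_lhs => arg 1; rw [hG]
    rw [nonloc_add_right]
  have hts : ∑' y', nonloc (xiOf ℓ k) (GxiL ℓ k a m2) (GxiL ℓ k a m2) μ μ' y y' =
      ∑' y', nonloc (xiOf ℓ k) (fun x z => Cxi 3 (xiOf ℓ k) (x - z)) (fun x z => Cxi 3 (xiOf ℓ k) (x - z)) μ μ' y y' +
        ∑' y', nonloc (xiOf ℓ k) (fun x z => Cxi 3 (xiOf ℓ k) (x - z)) (MxiL ℓ k a m2) μ μ' y y' +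
        ∑' y', nonloc (xiOf ℓ k) (MxiL ℓ k a m2) (GxiL ℓ k a m2) μ μ' y y' := by
    simp_rw [hsplit]
    rw [(sCC.add sCM).tsum_add sMG, sCC.tsum_add sCM]
  have hloc1 : GxiL ℓ k a m2 y y = Cxi 3 (xiOf ℓ k) (y - y) + MxiL ℓ k a m2 y y := by rw [MxiL]; ring
  have hloc2 : xiOf ℓ k * dK2 (xiOf ℓ k) μ (GxiL ℓ k a m2) y y =
      xiOf ℓ k * dK2 (xiOf ℓ k) μ (fun x z => Cxi 3 (xiOf ℓ k) (x - z)) y y +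
        (MxiL ℓ k a m2 y (y + unitVec μ) - MxiL ℓ k a m2 y y) := by
    simp only [dK2, MxiL]
    have hξ0 : xiOf ℓ k ≠ 0 := (xiOf_pos ℓ k).ne'
    field_simp
    ring
  unfold Pi2L
  rw [hts, hloc1, hloc2]
  by_cases h : μ = μ'
  · simp only [if_pos h]; ring
  · simp only [if_neg h]; ring

/-- **Π_{μμ′} OF (3.26) WITH THE INFINITE-LATTICE PROPAGATOR `G^ξ_{j₀}(0)` IN ALL THREE SLOTS IS BOUNDED UNIFORMLY IN THE
SPACING** — p. 437 *"we can estimate (3.16) by a constant"*, p. 441 *"If at least one propagator G_{j₀}(0) is replaced by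
G_{j₀}(0)(1 − m²_{j₀} − a_{j₀}P_{j₀})C^ξ, then we get a convergent expression. Hence it is enough to consider the expressions with
the propagator C^ξ only."* (our reading, outside the quotation: a divergence could only come from the pure-`C^ξ` term), p. 442
*"hence it is equal to 0"*, assembled ON THE PRINTED INFINITE LATTICE ξℤ³:
there is `Cst` (a function of `L` and the window) with `|Π[G^ξ_k(0),G^ξ_k(0),G^ξ_k(0)]_{μμ′}(y)| ≤ Cst·|tr q²|` for every `k ≥ 1`,
`a₋ ≤ a ≤ a₊`, `0 ≤ m² ≤ m²₊`, `μ, μ′ ∈ {1,2,3}`, `y ∈ ℤ³`.  Route: `G = C^ξ + M` (3.16); the pure-`C^ξ` kernel is ZERO (p20's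
`Pi2Z_Cxi_eq_zero`); the cross terms are bounded by `tsum_nonloc_conv_M_bound` and `tsum_nonloc_M_G_bound`; the local terms of
`M` by `|M| ≤ K`. [cite: Balaban1983Higgs3, (3.26) p.440; p.441] -/
theorem exists_Pi2L_GxiL_bound (hℓ : 1 ≤ ℓ) (amin aplus m2plus : ℝ) (ha : 0 < amin) :
    ∃ Cst : ℝ, 0 < Cst ∧ ∀ (k : ℕ), 1 ≤ k → ∀ (a m2 : ℝ), amin ≤ a → a ≤ aplus → 0 ≤ m2 → m2 ≤ m2plus →
      ∀ (τ : ℝ) (μ μ' : Fin 3) (y : ZSite 3),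
        |Pi2L (xiOf ℓ k) τ (GxiL ℓ k a m2) (GxiL ℓ k a m2) (GxiL ℓ k a m2) μ μ' y| ≤ Cst * |τ| := by
  obtain ⟨δ, C, K, hδ, hδh, hC1, hK, hB⟩ := exists_bounds hℓ amin aplus m2plus ha
  have hδ1 : δ ≤ 1 := hδh.trans (by norm_num)
  have hC0 : 0 ≤ C := le_trans (by norm_num) hC1
  set Cst : ℝ := C * K * (2 * Real.exp 1 + 1) * (833 / (δ / 2) ^ 3) + K * C * (1 + 4 * Real.exp 1) + K with hCst
  have hδh0 : 0 < δ / 2 := by linarith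
  refine ⟨Cst, by positivity, ?_⟩
  intro k hk a m2 ha1 ha2 hm1 hm2 τ μ μ' y
  obtain ⟨⟨l1, l2, l3, l4, l5, l6, l7, l8, l9⟩, bM, bd2, bunif, fub, -, -⟩ := hB k hk a m2 ha1 ha2 hm1 hm2
  have hξ := xiOf_pos ℓ k
  obtain ⟨sCM, hCM⟩ := tsum_nonloc_conv_M_bound hδ hδ1 hC0 hK.le l7 bd2 bunif μ μ' y
  obtain ⟨sMG, hMG⟩ := tsum_nonloc_M_G_bound hδ hδ1 hC0 l3 bM fub μ μ' y
  have sCC := summable_nonloc_conv_conv hδ hδ1 hC0 l7 l8 μ μ' y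
  rw [Pi2L_GxiL_decomp τ μ μ' y sCC sCM sMG, Pi2L_Cxi_eq_zero hξ τ μ μ' y, zero_add]
  have hloc : |(if μ = μ' then τ * MxiL ℓ k a m2 y (y + unitVec μ) else 0)| ≤ K * |τ| := by
    split_ifs
    · rw [abs_mul, mul_comm]; exact mul_le_mul_of_nonneg_right (bM _ _) (abs_nonneg _)
    · rw [abs_zero]; positivity
  calc |τ * ∑' y', nonloc (xiOf ℓ k) (fun x z => Cxi 3 (xiOf ℓ k) (x - z)) (MxiL ℓ k a m2) μ μ' y y' +
        τ * ∑' y', nonloc (xiOf ℓ k) (MxiL ℓ k a m2) (GxiL ℓ k a m2) μ μ' y y' -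
        (if μ = μ' then τ * MxiL ℓ k a m2 y (y + unitVec μ) else 0)|
      ≤ |τ * ∑' y', nonloc (xiOf ℓ k) (fun x z => Cxi 3 (xiOf ℓ k) (x - z)) (MxiL ℓ k a m2) μ μ' y y'| +
        |τ * ∑' y', nonloc (xiOf ℓ k) (MxiL ℓ k a m2) (GxiL ℓ k a m2) μ μ' y y'| +
        |(if μ = μ' then τ * MxiL ℓ k a m2 y (y + unitVec μ) else 0)| :=
        (abs_sub _ _).trans (add_le_add (abs_add_le _ _) le_rfl)
    _ ≤ |τ| * (C * K * (2 * Real.exp 1 + 1) * (833 / (δ / 2) ^ 3)) + |τ| * (K * C * (1 + 4 * Real.exp 1)) + K * |τ| := by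
        rw [abs_mul, abs_mul]
        exact add_le_add (add_le_add (mul_le_mul_of_nonneg_left hCM (abs_nonneg _))
          (mul_le_mul_of_nonneg_left hMG (abs_nonneg _))) hloc
    _ = Cst * |τ| := by rw [hCst]; ring

end Assembly

end

end Literature.MathematicalPhysics.QuantumFieldTheory.Balaban1983to89.B3Pi2ZeroLattice
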